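import Mathlib.Analysis.SpecialFunctions.Pow.Real
import Mathlib.Analysis.Complex.Exponential
import Mathlib.Data.Nat.Choose.Bounds
import HarnessLib

/-!
# Estimates for the first-moment count of random lifts (elementary real analysis)

Venture QEC (`Summits/Ventures/QEC`), item 04.EXIST: the arithmetic half of the existence proof of
exactly-biregular two-sided lossless expanders (`BiregularExpanderExistence`). For the union bound
`Σ_{s=1}^{γ n_A} C(n_A, s)·Σ_{m<(1-δ)Δ_A s} C(Δ_A n, m)(m/n)^{Δ_A s}` (the single-set count of `BiregularLift`
summed over the sets `S` of size `s`):

* `choose_le_exp_pow` — `C(N,k) ≤ (eN/k)^k`;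
* `inner_term_le` / `eps_le` — for `s ≥ 1`: `Σ_m C(Δ_A n, m)(m/n)^{Δ_A s} ≤ (2eΔ_A)^{Δ_A s}·y^{⌈δΔ_A s⌉}`,
  `y = Δ_A s/n ≤ 1`;
* `term_le_rho_pow` — times `C(n_A, s)`: `≤ ρ^s` with `ρ = K·y₀^{δΔ_A-1}`, `K = Kconst Δ_A Δ_B = eΔ_AΔ_B(2eΔ_A)^{Δ_A}`,
  `y₀ = Δ_AΔ_Bγ ≤ 1` (needs `δΔ_A > 1`);
* `yzero_spec` — `y₀ = (4K)^{-1/(δΔ_A-1)}` gives `K y₀^{δΔ_A-1} = 1/4`, `0 < y₀ ≤ 1`.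

All statements PROVED; the one definition `Kconst` names the constant. [folklore]
-/

namespace Summit.Ventures.QEC.Expanders

open Finset Real

/-! ### Elementary estimates -/

section Estimates

/-- `C(N,k) ≤ (eN/k)^k` (`C(N,k) ≤ N^k/k!` and `k^k/k! ≤ e^k`). [folklore] -/
theorem choose_le_exp_pow (N k : ℕ) (hk : 1 ≤ k) :
    ((N.choose k : ℕ) : ℝ) ≤ (Real.exp 1 * N / k) ^ k := by
  have hk' : (0 : ℝ) < k := by exact_mod_cast hk
  have h1 : ((N.choose k : ℕ) : ℝ) ≤ (N : ℝ) ^ k / k.factorial := Nat.choose_le_pow_div k N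
  have h2 : (k : ℝ) ^ k / k.factorial ≤ Real.exp (k : ℝ) := Real.pow_div_factorial_le_exp (k : ℝ) (Nat.cast_nonneg k) k
  have hfac : (0 : ℝ) < k.factorial := by exact_mod_cast Nat.factorial_pos k
  -- `N^k/k! = (N/k)^k · (k^k/k!) ≤ (N/k)^k e^k`
  have h3 : (N : ℝ) ^ k / k.factorial = ((N : ℝ) / k) ^ k * ((k : ℝ) ^ k / k.factorial) := by
    rw [div_pow]
    field_simp
  rw [h3] at h1
  calc ((N.choose k : ℕ) : ℝ) ≤ ((N : ℝ) / k) ^ k * ((k : ℝ) ^ k / k.factorial) := h1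
    _ ≤ ((N : ℝ) / k) ^ k * Real.exp (k : ℝ) :=
        mul_le_mul_of_nonneg_left h2 (pow_nonneg (div_nonneg (Nat.cast_nonneg _) hk'.le) _)
    _ = (Real.exp 1 * N / k) ^ k := by
        rw [← Real.exp_one_pow k, ← mul_pow]
        ring

/-- The inner term of the single-set bound: for `1 ≤ m`, `m ≤ (1-δ)Δ_A s`, `0 < n`, `y = Δ_A s/n ≤ 1`:
`C(Δ_A n, m)·(m/n)^{Δ_A s} ≤ (eΔ_A)^{Δ_A s} · y^{⌈δΔ_A s⌉}`. [folklore] -/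
theorem inner_term_le {dA n s m : ℕ} {δ : ℝ} (hdA : 1 ≤ dA) (hn : 0 < n) (hm1 : 1 ≤ m)
    (hm : (m : ℝ) ≤ (1 - δ) * dA * s) (hδ : 0 ≤ δ) (hy1 : (dA : ℝ) * s / n ≤ 1) :
    (((dA * n).choose m : ℕ) : ℝ) * ((m : ℝ) / n) ^ (dA * s)
      ≤ (Real.exp 1 * dA) ^ (dA * s) * ((dA : ℝ) * s / n) ^ ⌈δ * dA * s⌉₊ := by
  have hn' : (0 : ℝ) < n := by exact_mod_cast hn
  have hm' : (0 : ℝ) < m := by exact_mod_cast hm1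
  have hdA' : (1 : ℝ) ≤ dA := by exact_mod_cast hdA
  set y : ℝ := (dA : ℝ) * s / n with hydef
  have hy0 : 0 ≤ y := by rw [hydef]; positivity
  -- `m ≤ Δ_A s`
  have hmds_real : (m : ℝ) ≤ dA * s := by
    have h1 : (1 - δ) * dA * s ≤ dA * s := by
      have : 0 ≤ δ * dA * s := by positivity
      nlinarith
    exact hm.trans h1
  have hmds : m ≤ dA * s := by exact_mod_cast hmds_real
  -- `C(Δ_A n, m) ≤ (eΔ_A n/m)^m`
  have hC := choose_le_exp_pow (dA * n) m hm1
  -- split `(m/n)^{Δ_A s} = (m/n)^m (m/n)^{Δ_A s - m}`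
  have hsplit : ((m : ℝ) / n) ^ (dA * s) = ((m : ℝ) / n) ^ m * ((m : ℝ) / n) ^ (dA * s - m) := by
    rw [← pow_add, Nat.add_sub_cancel' hmds]
  -- `(eΔ_A n/m)^m (m/n)^m = (eΔ_A)^m ≤ (eΔ_A)^{Δ_A s}`
  have hedA1 : (1 : ℝ) ≤ Real.exp 1 * dA := by
    have he : (1 : ℝ) ≤ Real.exp 1 := Real.one_le_exp zero_le_one
    nlinarith
  have h1 : (Real.exp 1 * ↑(dA * n) / m) ^ m * ((m : ℝ) / n) ^ m ≤ (Real.exp 1 * dA) ^ (dA * s) := by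
    rw [← mul_pow]
    have heq : Real.exp 1 * ↑(dA * n) / m * ((m : ℝ) / n) = Real.exp 1 * dA := by
      push_cast
      field_simp
    rw [heq]
    exact pow_le_pow_right₀ hedA1 hmds
  -- `(m/n)^{Δ_A s - m} ≤ y^{Δ_A s - m} ≤ y^{⌈δΔ_A s⌉}`
  have hmn_le_y : (m : ℝ) / n ≤ y := by
    rw [hydef]; exact div_le_div_of_nonneg_right hmds_real hn'.le
  have hexp_ge : ⌈δ * dA * s⌉₊ ≤ dA * s - m := by
    refine Nat.ceil_le.2 ?_
    rw [Nat.cast_sub hmds]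
    push_cast
    nlinarith
  have h2 : ((m : ℝ) / n) ^ (dA * s - m) ≤ y ^ ⌈δ * dA * s⌉₊ :=
    calc ((m : ℝ) / n) ^ (dA * s - m) ≤ y ^ (dA * s - m) :=
          pow_le_pow_left₀ (div_nonneg hm'.le hn'.le) hmn_le_y _
      _ ≤ y ^ ⌈δ * dA * s⌉₊ := pow_le_pow_of_le_one hy0 hy1 hexp_ge
  calc (((dA * n).choose m : ℕ) : ℝ) * ((m : ℝ) / n) ^ (dA * s)
      ≤ (Real.exp 1 * ↑(dA * n) / m) ^ m * ((m : ℝ) / n) ^ (dA * s) :=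
        mul_le_mul_of_nonneg_right hC (pow_nonneg (div_nonneg hm'.le hn'.le) _)
    _ = ((Real.exp 1 * ↑(dA * n) / m) ^ m * ((m : ℝ) / n) ^ m) * ((m : ℝ) / n) ^ (dA * s - m) := by
        rw [hsplit, mul_assoc]
    _ ≤ (Real.exp 1 * dA) ^ (dA * s) * y ^ ⌈δ * dA * s⌉₊ :=
        mul_le_mul h1 h2 (pow_nonneg (div_nonneg hm'.le hn'.le) _) (pow_nonneg (by positivity) _)

/-- The single-set failure bound summed over the neighbourhood sizes: for `s ≥ 1`, `y = Δ_A s/n ≤ 1`, `0 ≤ δ`: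
`Σ_{m<⌈(1-δ)Δ_A s⌉} C(Δ_A n, m)(m/n)^{Δ_A s} ≤ (2eΔ_A)^{Δ_A s}·y^{⌈δΔ_A s⌉}` (at most `Δ_A s + 1 ≤ 2^{Δ_A s}` terms,
the term `m = 0` vanishes). [folklore] -/
theorem eps_le {dA n s : ℕ} {δ : ℝ} (hdA : 1 ≤ dA) (hn : 0 < n) (hs : 1 ≤ s) (hδ : 0 ≤ δ)
    (hy1 : (dA : ℝ) * s / n ≤ 1) :
    (∑ m ∈ Finset.range ⌈(1 - δ) * dA * s⌉₊, (((dA * n).choose m : ℕ) : ℝ) * ((m : ℝ) / n) ^ (dA * s))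
      ≤ (2 * Real.exp 1 * dA) ^ (dA * s) * ((dA : ℝ) * s / n) ^ ⌈δ * dA * s⌉₊ := by
  set M : ℕ := ⌈(1 - δ) * dA * s⌉₊ with hMdef
  set B : ℝ := (Real.exp 1 * dA) ^ (dA * s) * ((dA : ℝ) * s / n) ^ ⌈δ * dA * s⌉₊ with hBdef
  have hB0 : 0 ≤ B := by rw [hBdef]; positivity
  have hds : 1 ≤ dA * s := Nat.mul_pos (by omega) (by omega)
  -- each term `≤ B`
  have hterm : ∀ m ∈ Finset.range M,
      (((dA * n).choose m : ℕ) : ℝ) * ((m : ℝ) / n) ^ (dA * s) ≤ B := by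
    intro m hm
    rcases Nat.eq_zero_or_pos m with rfl | hm1
    · simp only [Nat.cast_zero, zero_div, zero_pow (by omega : dA * s ≠ 0), mul_zero]
      exact hB0
    · rw [Finset.mem_range, hMdef] at hm
      have hmreal : (m : ℝ) ≤ (1 - δ) * dA * s := by
        have h := Nat.lt_ceil.1 hm
        -- `m < ⌈x⌉` gives `m ≤ x`? only `m < x` if ... use `m + 1 ≤ ⌈x⌉ → m < x`
        by_contra hgt
        push Not at hgt
        have : ⌈(1 - δ) * (dA : ℝ) * s⌉₊ ≤ m := Nat.ceil_le.2 hgt.le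
        omega
      rw [hBdef]
      exact inner_term_le hdA hn hm1 hmreal hδ hy1
  -- number of terms `M ≤ Δ_A s + 1 ≤ 2^{Δ_A s}`
  have hM : M ≤ dA * s := by
    rw [hMdef]
    refine Nat.ceil_le.2 ?_
    push_cast
    have : 0 ≤ δ * dA * s := by positivity
    nlinarith
  have hM2 : (M : ℝ) ≤ (2 : ℝ) ^ (dA * s) := by
    have h1 : M < 2 ^ (dA * s) := lt_of_le_of_lt hM Nat.lt_two_pow_self
    exact_mod_cast h1.le
  calc (∑ m ∈ Finset.range M, (((dA * n).choose m : ℕ) : ℝ) * ((m : ℝ) / n) ^ (dA * s))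
      ≤ ∑ m ∈ Finset.range M, B := Finset.sum_le_sum hterm
    _ = M * B := by rw [Finset.sum_const, Finset.card_range, nsmul_eq_mul]
    _ ≤ (2 : ℝ) ^ (dA * s) * B := mul_le_mul_of_nonneg_right hM2 hB0
    _ = (2 * Real.exp 1 * dA) ^ (dA * s) * ((dA : ℝ) * s / n) ^ ⌈δ * dA * s⌉₊ := by
        rw [hBdef, ← mul_assoc, ← mul_pow]; ring

/-- The constant `K = eΔ_AΔ_B(2eΔ_A)^{Δ_A}` of the union bound. [folklore] -/
noncomputable def Kconst (dA dB : ℕ) : ℝ := Real.exp 1 * dA * dB * (2 * Real.exp 1 * dA) ^ dA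

/-- `K ≥ 1` (for `Δ_A, Δ_B ≥ 1`). [folklore] -/
theorem one_le_Kconst {dA dB : ℕ} (hdA : 1 ≤ dA) (hdB : 1 ≤ dB) : 1 ≤ Kconst dA dB := by
  have hdA' : (1 : ℝ) ≤ dA := by exact_mod_cast hdA
  have hdB' : (1 : ℝ) ≤ dB := by exact_mod_cast hdB
  have he : (1 : ℝ) ≤ Real.exp 1 := Real.one_le_exp zero_le_one
  unfold Kconst
  have h1a : (1 : ℝ) ≤ Real.exp 1 * dA := by nlinarith
  have h1 : (1 : ℝ) ≤ Real.exp 1 * dA * dB := by nlinarith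
  have h2 : (1 : ℝ) ≤ (2 * Real.exp 1 * dA) ^ dA := one_le_pow₀ (by nlinarith)
  exact one_le_mul_of_one_le_of_one_le h1 h2

/-- **The `s`-th term of the union bound**: for `1 ≤ s ≤ γ n_A` (`n_A = Δ_B n`), `0 < γ`, `y₀ = Δ_AΔ_Bγ ≤ 1`
and `δΔ_A > 1`: `C(n_A, s)·Σ_m C(Δ_A n, m)(m/n)^{Δ_A s} ≤ (K·y₀^{δΔ_A-1})^s`. [folklore] -/
theorem term_le_rho_pow {dA dB n s : ℕ} {δ γ : ℝ} (hdA : 1 ≤ dA) (hdB : 1 ≤ dB) (hn : 0 < n) (hs : 1 ≤ s)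
    (hδ : 1 < δ * dA) (hγ : 0 < γ) (hy0 : (dA : ℝ) * dB * γ ≤ 1) (hsγ : (s : ℝ) ≤ γ * (dB * n)) :
    (((dB * n).choose s : ℕ) : ℝ) *
        (∑ m ∈ Finset.range ⌈(1 - δ) * dA * s⌉₊, (((dA * n).choose m : ℕ) : ℝ) * ((m : ℝ) / n) ^ (dA * s))
      ≤ (Kconst dA dB * ((dA : ℝ) * dB * γ) ^ (δ * dA - 1)) ^ s := by
  have hn' : (0 : ℝ) < n := by exact_mod_cast hn
  have hs' : (0 : ℝ) < s := by exact_mod_cast hs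
  have hdA' : (1 : ℝ) ≤ dA := by exact_mod_cast hdA
  have hdB' : (1 : ℝ) ≤ dB := by exact_mod_cast hdB
  have hδ0 : 0 ≤ δ := by
    by_contra h; push Not at h
    have : δ * dA ≤ 0 := mul_nonpos_of_nonpos_of_nonneg h.le (by positivity)
    linarith
  set y : ℝ := (dA : ℝ) * s / n with hydef
  set y₀ : ℝ := (dA : ℝ) * dB * γ with hy₀def
  have hy_pos : 0 < y := by rw [hydef]; positivity
  have hy₀_pos : 0 < y₀ := by rw [hy₀def]; positivity
  have hy_le : y ≤ y₀ := by
    rw [hydef, hy₀def, div_le_iff₀ hn']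
    have := mul_le_mul_of_nonneg_left hsγ (by positivity : (0 : ℝ) ≤ dA)
    nlinarith
  have hy1 : y ≤ 1 := hy_le.trans hy0
  -- the two factors
  have hε := eps_le (δ := δ) hdA hn hs hδ0 hy1
  have hC := choose_le_exp_pow (dB * n) s hs
  set e_s : ℕ := ⌈δ * dA * s⌉₊ with hesdef
  have hes_ge : s ≤ e_s := by
    have h1 : (s : ℝ) ≤ δ * dA * s := by nlinarith
    have h2 : (s : ℝ) ≤ (e_s : ℝ) := h1.trans (by rw [hesdef]; exact Nat.le_ceil _)
    exact_mod_cast h2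
  -- `C(n_A,s) (2eΔ_A)^{Δ_A s} y^{e_s} = (eΔ_AΔ_B)^s (2eΔ_A)^{Δ_A s} y^{e_s - s}` using `(e n_A/s)^s y^s = (eΔ_AΔ_B)^s`
  have hkey : (Real.exp 1 * ↑(dB * n) / s) ^ s * y ^ e_s
      = (Real.exp 1 * dA * dB) ^ s * y ^ (e_s - s) := by
    have hsplit : y ^ e_s = y ^ s * y ^ (e_s - s) := by rw [← pow_add, Nat.add_sub_cancel' hes_ge]
    rw [hsplit, ← mul_assoc, ← mul_pow]
    congr 2
    rw [hydef]; push_cast; field_simp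
  -- `y^{e_s - s} ≤ y₀^{e_s - s} ≤ y₀^{(δΔ_A - 1)s}`
  have hpow1 : y ^ (e_s - s) ≤ y₀ ^ (e_s - s) := pow_le_pow_left₀ hy_pos.le hy_le _
  have hpow2 : y₀ ^ (e_s - s) ≤ y₀ ^ ((δ * dA - 1) * s) := by
    rw [← Real.rpow_natCast]
    refine Real.rpow_le_rpow_of_exponent_ge hy₀_pos hy0 ?_
    rw [Nat.cast_sub hes_ge]
    have h1 : δ * dA * s ≤ (e_s : ℝ) := by rw [hesdef]; exact Nat.le_ceil _
    nlinarith
  -- assemble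
  have hK : (Real.exp 1 * dA * dB) ^ s * (2 * Real.exp 1 * dA) ^ (dA * s) = Kconst dA dB ^ s := by
    unfold Kconst
    ring
  have hrhs : (Kconst dA dB * y₀ ^ (δ * dA - 1)) ^ s = Kconst dA dB ^ s * y₀ ^ ((δ * dA - 1) * s) := by
    rw [mul_pow, ← Real.rpow_mul_natCast hy₀_pos.le]
  rw [hrhs]
  calc (((dB * n).choose s : ℕ) : ℝ) *
        (∑ m ∈ Finset.range ⌈(1 - δ) * dA * s⌉₊, (((dA * n).choose m : ℕ) : ℝ) * ((m : ℝ) / n) ^ (dA * s))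
      ≤ (Real.exp 1 * ↑(dB * n) / s) ^ s * ((2 * Real.exp 1 * dA) ^ (dA * s) * y ^ e_s) :=
        mul_le_mul hC hε (Finset.sum_nonneg fun m _ => by positivity) (by positivity)
    _ = (2 * Real.exp 1 * dA) ^ (dA * s) * ((Real.exp 1 * ↑(dB * n) / s) ^ s * y ^ e_s) := by ring
    _ = (2 * Real.exp 1 * dA) ^ (dA * s) * ((Real.exp 1 * dA * dB) ^ s * y ^ (e_s - s)) := by rw [hkey]
    _ = Kconst dA dB ^ s * y ^ (e_s - s) := by rw [← hK]; ring
    _ ≤ Kconst dA dB ^ s * y₀ ^ ((δ * dA - 1) * s) :=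
        mul_le_mul_of_nonneg_left (hpow1.trans hpow2) (pow_nonneg (by unfold Kconst; positivity) _)

/-- The choice of `y₀ = Δ_AΔ_Bγ`: `y₀ = (4K)^{-1/(δΔ_A - 1)}` makes `K y₀^{δΔ_A-1} = 1/4` and `y₀ ≤ 1`. [folklore] -/
theorem yzero_spec {dA dB : ℕ} {δ : ℝ} (hdA : 1 ≤ dA) (hdB : 1 ≤ dB) (hδ : 1 < δ * dA) :
    let y₀ : ℝ := (1 / (4 * Kconst dA dB)) ^ (1 / (δ * dA - 1))
    0 < y₀ ∧ y₀ ≤ 1 ∧ Kconst dA dB * y₀ ^ (δ * dA - 1) = 1 / 4 := by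
  intro y₀
  have hK := one_le_Kconst hdA hdB
  have hK0 : 0 < Kconst dA dB := by linarith
  have hc : 0 < δ * dA - 1 := by linarith
  have hbase0 : 0 < 1 / (4 * Kconst dA dB) := by positivity
  have hbase1 : 1 / (4 * Kconst dA dB) ≤ 1 := by
    rw [div_le_one (by positivity)]; linarith
  refine ⟨Real.rpow_pos_of_pos hbase0 _, Real.rpow_le_one hbase0.le hbase1 (by positivity), ?_⟩
  show Kconst dA dB * ((1 / (4 * Kconst dA dB)) ^ (1 / (δ * dA - 1))) ^ (δ * dA - 1) = 1 / 4
  rw [one_div (δ * dA - 1), Real.rpow_inv_rpow hbase0.le hc.ne']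
  field_simp

end Estimates


end Summit.Ventures.QEC.Expanders
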